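import Summits.BirchSwinnertonDyer.BirchSwinnertonDyer.Theorems.ManinLocalTwoThreeRelativeIharaParabolicInstance
import Summits.BirchSwinnertonDyer.BirchSwinnertonDyer.Theorems.ManinLocalTwoThreeGenerationOfRelativeIharaTwo
import HarnessLib

/-!
# E-es-22 `MultiShiftClassGenerationTwo` through PARABOLIC relative Ihara only (the hook for the C₃-residual line §25):
# crux C2 `ManinOddAtFour` (stmt-BirchSwinnertonDyer-22967), generation stub

Summit `BirchSwinnertonDyer`, route `ManinLocalTwoThree` (cell bsd-f2-manin).  In the lead's skeleton `kato_shift_two` v5 the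
C2 crux is composed from {`stub_katoFactTwoReal` (Kato F♯, Literature), `stub_relativeIharaBarTwo : ∀ t n,
RelativeIharaShiftVanishingBar 2 t n`, `stub_cThreeImageResidual` (3 950 `C₃`-image classes), `stub_minimalReducibleResidual`}
with E-es-22 obtained by `multiShiftClassGenerationTwo_of_relativeIharaShiftVanishingBar`.  THIS FILE SHOWS THE RELATIVE-IHARA
STUB IS NOT NEEDED for E-es-22: the cocycles fed to it by the gen-2 reduction are PERIOD functionals and their degeneracy
pull-backs, all PARABOLIC, and relative Ihara for parabolic classes is a tree theorem (`relativeIhara_eq_zero_of_parabolic`, p3).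

* `eq_zero_of_altSum_conjAt_eq_zero_parabolic` — the gen-2 TELESCOPE (`eq_zero_of_altSum_conjAt_eq_zero`) with parabolicity
  threaded through: the one-step differences `π_d^* u − π_1^* u` of a parabolic cocycle are parabolic (`diag_intertwine`);
* `functional_eq_zero_of_parabolicShiftVanishing_two` — the per-curve core at `p = 2` with the vanishing hypotheses
  (moduli `2³` and `t` for odd primes `t ∥ N`) required only for PARABOLIC classes;
* **`multiShiftClassGenerationTwo_of_parabolicVanishing`** — E-es-22 for ALL `W[2]`-irreducible classes from the PARABOLIC
  relative Ihara vanishing for the curve's own system `a(W) mod 2` at the moduli `2³`, `t` (the hook for the planner's §25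
  line E-es-36/E-es-40 on the `C₃`-image residual); `multiShiftClassGenerationTwo_of_cThreeResidual_parabolic` — the
  per-curve form of p2's `multiShiftClassGenerationTwo_of_cThreeResidual`, through the parabolic instance only.

So C2 = {F♯, the `C₃`-image residual, the reducible orbit-minimal residual}: the relative-Ihara input is DISCHARGED on the
consumer side.  Nothing about BSD or Manin's conjecture is proved here.
References: HOME/MEMO-es.md §19.4, §21.3, §22–§23, §25 (cell bsd-f2-manin).
-/

set_option autoImplicit false
set_option linter.dupNamespace false

noncomputable section

open scoped Classical MatrixGroups ModularForm BigOperators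

open CongruenceSubgroup Matrix.SpecialLinearGroup ModularGroup
  Literature.NumberTheory.EllipticCurves Literature.NumberTheory.EllipticCurves.ModularForms
  Literature.NumberTheory.EllipticCurves.ModularForms.HidaCohomology
  Summit.BirchSwinnertonDyer.Rank1Residual.ManinAdditive

namespace Summit.BirchSwinnertonDyer.BirchSwinnertonDyer.Theorems.ManinLocalTwoThree

/-! ### §1  Degeneracy pull-backs preserve parabolicity -/

/-- If `γ ∈ Γ₀(L')` fixes a point of `P¹(ℚ)`, so does `δ_d(γ) = diag(d,1) γ diag(d,1)⁻¹ ∈ Γ₀(L)` (it fixes `diag(d,1)·c`).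
[folklore] -/
theorem exists_smul_eq_degeneracyConj {L L' d : ℕ} [NeZero d] (h : L * d ∣ L') (γ : Gamma0 L') {c : OnePoint ℚ}
    (hc : mapGL ℚ (γ : SL(2, ℤ)) • c = c) :
    ∃ c' : OnePoint ℚ, mapGL ℚ ((Gamma0.degeneracyConj L L' d h γ : Gamma0 L) : SL(2, ℤ)) • c' = c' := by
  have hdet : (!![(d : ℚ), 0; 0, 1] : Matrix (Fin 2) (Fin 2) ℚ).det ≠ 0 := by
    rw [Matrix.det_fin_two_of]; simp [NeZero.ne d]
  let A : GL (Fin 2) ℚ := Matrix.GeneralLinearGroup.mkOfDetNeZero _ hdet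
  have hA : (A : Matrix (Fin 2) (Fin 2) ℚ) = !![(d : ℚ), 0; 0, 1] := rfl
  refine ⟨A • c, ?_⟩
  rw [← mul_smul, ← diag_intertwine h A hA γ, mul_smul, hc]

/-- A parabolic cochain on `Γ₀(L)` pulls back to parabolic cochains `π_d^* u`, `π_1^* u` on `Γ₀(L')`, hence so is their
difference. [folklore] -/
theorem parabolic_degeneracyPullback_sub {L L' d : ℕ} [NeZero d] (h : L * d ∣ L') (h1 : L * 1 ∣ L') {K : Type*} [CommRing K]
    (u : Gamma0 L → Fin 1 → K) (hpar : ∀ γ : Gamma0 L, ∀ c : OnePoint ℚ, mapGL ℚ (γ : SL(2, ℤ)) • c = c → u γ 0 = 0)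
    (γ : Gamma0 L') (c : OnePoint ℚ) (hc : mapGL ℚ (γ : SL(2, ℤ)) • c = c) :
    (degeneracyPullback 0 L L' d K h u - degeneracyPullback 0 L L' 1 K h1 u) γ 0 = 0 := by
  rw [Pi.sub_apply, Pi.sub_apply, degeneracyPullback_zero_apply, degeneracyPullback_zero_apply]
  obtain ⟨c', hc'⟩ := exists_smul_eq_degeneracyConj h γ hc
  have h2 : mapGL ℚ ((Gamma0.degeneracyConj L L' 1 h1 γ : Gamma0 L) : SL(2, ℤ)) • c = c := by
    rw [Gamma0.coe_degeneracyConj_one]; exact hc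
  rw [hpar _ c' hc', hpar _ c h2, sub_zero]

/-! ### §2  The telescope for parabolic classes -/

/-- **Telescope, parabolic form**: as `eq_zero_of_altSum_conjAt_eq_zero`, with the single-step vanishing required only for
PARABOLIC generalised eigen-cocycles and the input cocycle assumed parabolic. [folklore] -/
theorem eq_zero_of_altSum_conjAt_eq_zero_parabolic {K : Type*} [Field K] (S : Finset ℕ) (lam : ℕ → K) (B : ℕ) :
    ∀ (ds : List ℕ), ds.Nodup → (∀ d ∈ ds, 0 < d) →
      (∀ d ∈ ds, ∀ (L' : ℕ) [NeZero L'] [NeZero d] (v : cocycles 0 L' K), B ∣ L' →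
        (∀ q : ℕ, q.Prime → q ∣ L' * d → q ∈ S) → IsHeckeGenEigenvector S lam v →
        (∀ γ : Gamma0 L', ∀ c : OnePoint ℚ, mapGL ℚ (γ : SL(2, ℤ)) • c = c → (v : Gamma0 L' → Fin 1 → K) γ 0 = 0) →
        degeneracyPullback 0 L' (L' * d) d K dvd_rfl (v : Gamma0 L' → Fin 1 → K) =
          degeneracyPullback 0 L' (L' * d) 1 K (by simp) (v : Gamma0 L' → Fin 1 → K) →
        v = 0) →
      ∀ (L M : ℕ) [NeZero L] [NeZero M], B ∣ L → M = L * ds.prod → (∀ q : ℕ, q.Prime → q ∣ M → q ∈ S) →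
        ∀ u : cocycles 0 L K, IsHeckeGenEigenvector S lam u →
          (∀ γ : Gamma0 L, ∀ c : OnePoint ℚ, mapGL ℚ (γ : SL(2, ℤ)) • c = c → (u : Gamma0 L → Fin 1 → K) γ 0 = 0) →
          (∀ (γ : Gamma0 M) (i : Fin 1),
            ∑ T ∈ ds.toFinset.powerset,
              (-1 : ℤ) ^ T.card • (u : Gamma0 L → Fin 1 → K) (conjAt L M (∏ t ∈ T, t) γ) i = 0) →
          u = 0 := by
  intro ds
  induction ds with
  | nil =>
    intro _ _ _ L M _ _ _ hM _ u _ _ hsum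
    have hML : M = L := by simpa using hM
    subst hML
    apply Subtype.ext
    funext γ i
    have h := hsum γ i
    simp only [List.toFinset_nil, Finset.powerset_empty, Finset.sum_singleton, Finset.card_empty, pow_zero,
      Finset.prod_empty, one_smul, conjAt_self_one] at h
    exact h
  | cons d ds ih =>
    intro hnd hpos hRI L M _ _ hB hM hS u hu hupar hsum
    obtain ⟨hdds, hnd'⟩ := List.nodup_cons.mp hnd
    have hd0 : 0 < d := hpos d List.mem_cons_self
    haveI : NeZero d := NeZero.of_pos hd0
    haveI : NeZero (L * d) := ⟨Nat.mul_ne_zero (NeZero.ne L) hd0.ne'⟩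
    have hLdM : L * d ∣ M := ⟨ds.prod, by rw [hM, List.prod_cons, mul_assoc]⟩
    have hS₁ : ∀ q : ℕ, q.Prime → q ∣ L * d → q ∈ S := fun q hq hqd => hS q hq (hqd.trans hLdM)
    set v : cocycles 0 (L * d) K :=
      degeneracyPullbackZ 0 L (L * d) d K dvd_rfl u - degeneracyPullbackZ 0 L (L * d) 1 K (by simp) u with hv
    have hvgen : IsHeckeGenEigenvector S lam v := by
      intro ℓ _ hℓ hℓS
      exact Submodule.sub_mem _ (isHeckeGenEigenvector_degeneracyPullbackZ dvd_rfl hS₁ hu ℓ hℓ hℓS)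
        (isHeckeGenEigenvector_degeneracyPullbackZ (by simp) hS₁ hu ℓ hℓ hℓS)
    have hcoe : (v : Gamma0 (L * d) → Fin 1 → K) =
        degeneracyPullback 0 L (L * d) d K dvd_rfl (u : Gamma0 L → Fin 1 → K) -
          degeneracyPullback 0 L (L * d) 1 K (by simp) (u : Gamma0 L → Fin 1 → K) := by
      rw [hv, Submodule.coe_sub, coe_degeneracyPullbackZ, coe_degeneracyPullbackZ]
    -- NEW: `v` is parabolic
    have hvpar : ∀ γ : Gamma0 (L * d), ∀ c : OnePoint ℚ, mapGL ℚ (γ : SL(2, ℤ)) • c = c →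
        (v : Gamma0 (L * d) → Fin 1 → K) γ 0 = 0 := by
      intro γ c hc
      rw [hcoe]
      exact parabolic_degeneracyPullback_sub dvd_rfl (by simp) _ hupar γ c hc
    have hdnot : d ∉ ds.toFinset := fun h => hdds (List.mem_toFinset.mp h)
    have hsum' : ∀ (γ : Gamma0 M) (i : Fin 1),
        ∑ T ∈ ds.toFinset.powerset,
          (-1 : ℤ) ^ T.card • (v : Gamma0 (L * d) → Fin 1 → K) (conjAt (L * d) M (∏ t ∈ T, t) γ) i = 0 := by
      intro γ i
      have h := hsum γ i
      rw [List.toFinset_cons,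
        sum_powerset_insert_alternating hdnot (fun D => (u : Gamma0 L → Fin 1 → K) (conjAt L M D γ) i),
        sub_eq_zero] at h
      have hterm : ∀ T ∈ ds.toFinset.powerset,
          (-1 : ℤ) ^ T.card • (v : Gamma0 (L * d) → Fin 1 → K) (conjAt (L * d) M (∏ t ∈ T, t) γ) i =
            (-1 : ℤ) ^ T.card • (u : Gamma0 L → Fin 1 → K) (conjAt L M (d * ∏ t ∈ T, t) γ) i -
              (-1 : ℤ) ^ T.card • (u : Gamma0 L → Fin 1 → K) (conjAt L M (∏ t ∈ T, t) γ) i := by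
        intro T hT
        have hTpos : (∏ t ∈ T, t) ≠ 0 := Finset.prod_ne_zero_iff.mpr fun t ht =>
          (hpos t (List.mem_cons_of_mem d (List.mem_toFinset.mp (Finset.mem_powerset.mp hT ht)))).ne'
        have hTdvd : L * d * ∏ t ∈ T, t ∣ M := by
          rw [hM, List.prod_cons, ← mul_assoc]
          refine mul_dvd_mul_left (L * d) ?_
          have hprod : ds.prod = ∏ t ∈ ds.toFinset, t := by
            rw [List.prod_toFinset (fun t : ℕ => t) hnd', List.map_id']
          rw [hprod]
          exact Finset.prod_dvd_prod_of_subset _ _ _ (Finset.mem_powerset.mp hT)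
        rw [← smul_sub, hcoe, Pi.sub_apply, Pi.sub_apply, degeneracyPullback_zero_eq_conjAt,
          degeneracyPullback_zero_eq_conjAt, conjAt_conjAt hTpos hd0.ne' hTdvd dvd_rfl,
          conjAt_conjAt hTpos one_ne_zero hTdvd (by simp), one_mul]
      rw [Finset.sum_congr rfl hterm, Finset.sum_sub_distrib, sub_eq_zero]
      exact h.symm
    have hv0 : v = 0 :=
      ih hnd' (fun e he => hpos e (List.mem_cons_of_mem d he)) (fun e he => hRI e (List.mem_cons_of_mem d he))
        (L * d) M (hB.mul_right d) (by rw [hM, List.prod_cons, mul_assoc]) hS v hvgen hvpar hsum'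
    have heq : degeneracyPullback 0 L (L * d) d K dvd_rfl (u : Gamma0 L → Fin 1 → K) =
        degeneracyPullback 0 L (L * d) 1 K (by simp) (u : Gamma0 L → Fin 1 → K) := by
      rw [← sub_eq_zero, ← hcoe, hv0, Submodule.coe_zero]
    exact hRI d List.mem_cons_self L u hB hS₁ hu hupar heq

/-! ### §3  The per-curve core at `p = 2`, parabolic form, and E-es-22 from the `C₃` residual -/

/-- **Per-curve core at `p = 2`, parabolic form**: as `functional_eq_zero_of_shiftVanishing_two`, but the single-shift vanishing
hypotheses (moduli `2³` and odd primes `t`) are only required for PARABOLIC generalised eigen-cocycles. [folklore] -/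
theorem functional_eq_zero_of_parabolicShiftVanishing_two {W : WeierstrassCurve ℚ} [W.IsElliptic] {N : ℕ} [NeZero N]
    {f : CuspForm (Gamma0 N) 2} (hf : IsNewformOf W f) (h4 : 2 ^ 2 ∣ N) (φ : ↥(periodLattice f) →+ ZMod 2)
    (hφ : ∀ x : ↥(periodLattice f), (x : ℂ) ∈
      periodLattice (∑ T ∈ (insert 8 (N.primeFactors.filter fun q => ¬ q ^ 2 ∣ N)).powerset,
        (-1 : ℂ) ^ T.card • degeneracyMap0 N (8 * N ^ 2) (∏ t ∈ T, t - 1 + 1) 2 f) → φ x = 0)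
    (hvan8 : ∀ (L' : ℕ) [NeZero L'] (S : Finset ℕ) (v : cocycles 0 L' (ZMod 2)), N ∣ L' →
      (∀ q : ℕ, q.Prime → q ∣ 2 * 2 * L' → q ∈ S) →
      IsHeckeGenEigenvector S (fun ℓ : ℕ => ((W.LFunction ℓ : ℤ) : ZMod 2)) v →
      (∀ γ : Gamma0 L', ∀ c : OnePoint ℚ, mapGL ℚ (γ : SL(2, ℤ)) • c = c → (v : Gamma0 L' → Fin 1 → ZMod 2) γ 0 = 0) →
      degeneracyPullback 0 L' (L' * 2 ^ 3) (2 ^ 3) (ZMod 2) dvd_rfl (v : Gamma0 L' → Fin 1 → ZMod 2) =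
        degeneracyPullback 0 L' (L' * 2 ^ 3) 1 (ZMod 2) (by simp) (v : Gamma0 L' → Fin 1 → ZMod 2) →
      v = 0)
    (hvanq : ∀ t : ℕ, t.Prime → t ≠ 2 →
      ∀ (L' : ℕ) [NeZero L'] [NeZero t] (S : Finset ℕ) (v : cocycles 0 L' (ZMod 2)), N ∣ L' →
      (∀ q : ℕ, q.Prime → q ∣ 2 * t * L' → q ∈ S) →
      IsHeckeGenEigenvector S (fun ℓ : ℕ => ((W.LFunction ℓ : ℤ) : ZMod 2)) v →
      (∀ γ : Gamma0 L', ∀ c : OnePoint ℚ, mapGL ℚ (γ : SL(2, ℤ)) • c = c → (v : Gamma0 L' → Fin 1 → ZMod 2) γ 0 = 0) →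
      degeneracyPullback 0 L' (L' * t ^ 1) (t ^ 1) (ZMod 2) dvd_rfl (v : Gamma0 L' → Fin 1 → ZMod 2) =
        degeneracyPullback 0 L' (L' * t ^ 1) 1 (ZMod 2) (by simp) (v : Gamma0 L' → Fin 1 → ZMod 2) →
      v = 0) :
    φ = 0 := by
  haveI : Fact (Nat.Prime 2) := ⟨Nat.prime_two⟩
  have hN0 : 0 < N := Nat.pos_of_ne_zero (NeZero.ne N)
  have h4' : 4 ∣ N := by norm_num at h4; exact h4
  have h2N : 2 ∣ N := dvd_trans (by norm_num) h4'
  set G : Finset ℕ := N.primeFactors.filter fun q => ¬ q ^ 2 ∣ N with hG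
  have hGprime : ∀ q ∈ G, q.Prime ∧ ¬ q ^ 2 ∣ N := fun q hq => by
    rw [hG, Finset.mem_filter] at hq
    exact ⟨(Nat.mem_primeFactors.mp hq.1).1, hq.2⟩
  have hGne2 : ∀ q ∈ G, q ≠ 2 := by
    rintro q hq rfl
    exact (hGprime 2 hq).2 h4
  set ds : List ℕ := (2 ^ 3) :: (G.toList.map fun t => t ^ 1) with hds
  have hmap : (G.toList.map fun t => t ^ 1) = G.toList := by simp
  have h8G : (2 ^ 3 : ℕ) ∉ G.toList := fun h => by
    have h8 := (hGprime _ (Finset.mem_toList.mp h)).1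
    norm_num at h8
  have hnd : ds.Nodup := by
    rw [hds, hmap]
    exact List.nodup_cons.mpr ⟨h8G, Finset.nodup_toList G⟩
  have hpos : ∀ d ∈ ds, 0 < d := by
    intro d hd
    rw [hds, hmap] at hd
    rcases List.mem_cons.mp hd with rfl | hd
    · norm_num
    · exact (hGprime d (Finset.mem_toList.mp hd)).1.pos
  have hdsF : ds.toFinset = insert 8 G := by
    rw [hds, hmap, List.toFinset_cons, Finset.toList_toFinset]
    norm_num
  have hprod0 : ds.prod ≠ 0 := fun h0 => lt_irrefl 0 (hpos 0 (List.prod_eq_zero_iff.mp h0))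
  set M : ℕ := N * ds.prod with hM
  have hM0 : M ≠ 0 := Nat.mul_ne_zero (NeZero.ne N) hprod0
  haveI : NeZero M := ⟨hM0⟩
  have hNM : N ∣ M := dvd_mul_right N _
  have hL : 1 < M := lt_of_lt_of_le (by omega : 1 < N) (Nat.le_of_dvd (Nat.pos_of_ne_zero hM0) hNM)
  set S : Finset ℕ := M.primeFactors with hS
  have hSM : ∀ q : ℕ, q.Prime → q ∣ M → q ∈ S := fun q hq hqd =>
    (Nat.mem_primeFactors_of_ne_zero hM0).mpr ⟨hq, hqd⟩
  set u : cocycles 0 N (ZMod 2) :=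
    ⟨fun (γ : Gamma0 N) (_ : Fin 1) => φ ⟨cuspSymbol f γ, cuspSymbol_mem_periodLattice f γ⟩,
      functionalCocycle_mem_cocycles f φ⟩ with hu
  have hgen : IsHeckeGenEigenvector S (fun ℓ : ℕ => ((W.LFunction ℓ : ℤ) : ZMod 2)) u :=
    isHeckeGenEigenvector_functionalCocycle hf φ S
  have hupar : ∀ γ : Gamma0 N, ∀ c : OnePoint ℚ, mapGL ℚ (γ : SL(2, ℤ)) • c = c →
      (u : Gamma0 N → Fin 1 → ZMod 2) γ 0 = 0 := fun γ c hc => periodFunctional_parabolic f φ γ hc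
  have hRI : ∀ d ∈ ds, ∀ (L' : ℕ) [NeZero L'] [NeZero d] (v : cocycles 0 L' (ZMod 2)), N ∣ L' →
      (∀ q : ℕ, q.Prime → q ∣ L' * d → q ∈ S) →
      IsHeckeGenEigenvector S (fun ℓ : ℕ => ((W.LFunction ℓ : ℤ) : ZMod 2)) v →
      (∀ γ : Gamma0 L', ∀ c : OnePoint ℚ, mapGL ℚ (γ : SL(2, ℤ)) • c = c → (v : Gamma0 L' → Fin 1 → ZMod 2) γ 0 = 0) →
      degeneracyPullback 0 L' (L' * d) d (ZMod 2) dvd_rfl (v : Gamma0 L' → Fin 1 → ZMod 2) =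
        degeneracyPullback 0 L' (L' * d) 1 (ZMod 2) (by simp) (v : Gamma0 L' → Fin 1 → ZMod 2) →
      v = 0 := by
    intro d hd
    rw [hds] at hd
    rcases List.mem_cons.mp hd with rfl | hd
    · intro L' _ _ v hNL hS' hv hvp heq
      refine hvan8 L' S v hNL (fun q hq hqd => ?_) hv hvp heq
      rcases (Nat.Prime.dvd_mul hq).mp hqd with h | h
      · have h2 : q ∣ 2 := by rcases (Nat.Prime.dvd_mul hq).mp h with h | h <;> exact h
        have hq2 : q = 2 := (Nat.prime_dvd_prime_iff_eq hq Nat.prime_two).mp h2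
        subst hq2
        exact hS' 2 hq (dvd_mul_of_dvd_right (by norm_num) _)
      · exact hS' q hq (h.mul_right _)
    · obtain ⟨t, ht, rfl⟩ := List.mem_map.mp hd
      have htp := (hGprime t (Finset.mem_toList.mp ht)).1
      have ht2 := hGne2 t (Finset.mem_toList.mp ht)
      intro L' _ _ v hNL hS' hv hvp heq
      haveI : NeZero t := ⟨htp.ne_zero⟩
      refine hvanq t htp ht2 L' S v hNL (fun q hq hqd => ?_) hv hvp heq
      rcases (Nat.Prime.dvd_mul hq).mp hqd with h | h
      · rcases (Nat.Prime.dvd_mul hq).mp h with h | h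
        · have hq2 : q = 2 := (Nat.prime_dvd_prime_iff_eq hq Nat.prime_two).mp h
          subst hq2
          exact hS' 2 hq ((h2N.trans hNL).mul_right _)
        · exact hS' q hq (dvd_mul_of_dvd_right (by rw [pow_one]; exact h) _)
      · exact hS' q hq (h.mul_right _)
  have hsum : ∀ (γ : Gamma0 M) (i : Fin 1),
      ∑ T ∈ ds.toFinset.powerset,
        (-1 : ℤ) ^ T.card • (u : Gamma0 N → Fin 1 → ZMod 2) (conjAt N M (∏ t ∈ T, t) γ) i = 0 := by
    intro γ i
    have he : ((γ : SL(2, ℤ)) 1 1 : ℤ) ≠ 0 := apply_one_one_ne_zero_of_one_lt hL γ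
    have hterm : ∀ T ∈ ds.toFinset.powerset,
        (-1 : ℤ) ^ T.card • (u : Gamma0 N → Fin 1 → ZMod 2) (conjAt N M (∏ t ∈ T, t) γ) i =
          φ ((-1 : ℤ) ^ T.card •
            ⟨cuspSymbol f (conjAt N M (∏ t ∈ T, t) γ), cuspSymbol_mem_periodLattice f _⟩) := by
      intro T _
      rw [map_zsmul]
    rw [Finset.sum_congr rfl hterm, ← map_sum]
    apply hφ
    rw [AddSubmonoidClass.coe_finsetSum, periodLattice_multiShiftOldform_eq_closure_columns f h4', ← hdsF]
    apply AddSubgroup.subset_closure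
    refine ⟨((γ : SL(2, ℤ)) 0 1 : ℤ), ((γ : SL(2, ℤ)) 1 1 : ℤ), he, ?_, ?_⟩
    · have hN' : IsCoprime ((γ : SL(2, ℤ)) 1 1 : ℤ) (M : ℤ) := isCoprime_apply_one_one_level γ
      exact (hN'.of_isCoprime_of_dvd_right (Int.natCast_dvd_natCast.mpr hNM)).mul_right
        (isCoprime_apply_zero_one_apply_one_one γ).symm
    · refine Finset.sum_congr rfl fun T hT => ?_
      have hTpos : (∏ t ∈ T, t) ≠ 0 := Finset.prod_ne_zero_iff.mpr fun t ht =>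
        (hpos t (List.mem_toFinset.mp (Finset.mem_powerset.mp hT ht))).ne'
      haveI : NeZero (∏ t ∈ T, t) := ⟨hTpos⟩
      have hTdvd : N * ∏ t ∈ T, t ∣ M := by
        refine mul_dvd_mul_left N ?_
        have hprod : ds.prod = ∏ t ∈ ds.toFinset, t := by
          rw [List.prod_toFinset (fun t : ℕ => t) hnd, List.map_id']
        rw [hprod]
        exact Finset.prod_dvd_prod_of_subset _ _ _ (Finset.mem_powerset.mp hT)
      have h01 : ((Gamma0.degeneracyConj N M (∏ t ∈ T, t) hTdvd γ : SL(2, ℤ)) 0 1 : ℤ) =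
          ((∏ t ∈ T, t : ℕ) : ℤ) * (γ : SL(2, ℤ)) 0 1 := rfl
      have h11 : ((Gamma0.degeneracyConj N M (∏ t ∈ T, t) hTdvd γ : SL(2, ℤ)) 1 1 : ℤ) =
          (γ : SL(2, ℤ)) 1 1 := rfl
      rw [AddSubgroupClass.coe_zsmul]
      show (-1 : ℤ) ^ T.card • cuspSymbol f (conjAt N M (∏ t ∈ T, t) γ) = _
      rw [conjAt_eq hTdvd γ, cuspSymbol_eq_modularSymbol_div_sub f _ (by rw [h11]; exact he), h01, h11,
        zsmul_eq_mul]
      have harg : ((((∏ t ∈ T, t : ℕ) : ℤ) * (γ : SL(2, ℤ)) 0 1 : ℤ) : ℚ) / (((γ : SL(2, ℤ)) 1 1 : ℤ) : ℚ) =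
          ((((γ : SL(2, ℤ)) 0 1 * ∏ t ∈ T, (t : ℤ) : ℤ)) : ℚ) / (((γ : SL(2, ℤ)) 1 1 : ℤ) : ℚ) := by
        push_cast
        ring
      rw [harg]
      push_cast
      ring
  have hu0 : u = 0 :=
    eq_zero_of_altSum_conjAt_eq_zero_parabolic S _ N ds hnd hpos hRI N M (dvd_refl N) hM hSM u hgen hupar hsum
  ext x
  have hx : (x : ℂ) ∈ (periodLattice f : Set ℂ) := x.2
  rw [coe_periodLattice_eq_range] at hx
  obtain ⟨γ, hγ⟩ := hx
  have hxγ : x = ⟨cuspSymbol f γ, cuspSymbol_mem_periodLattice f γ⟩ := Subtype.ext hγ.symm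
  have h0 : (u : Gamma0 N → Fin 1 → ZMod 2) γ 0 = 0 := by rw [hu0]; rfl
  rw [hxγ, AddMonoidHom.zero_apply]
  exact h0

/-- **E-es-22 for ALL `W[2]`-irreducible classes from PARABOLIC relative Ihara for the curve's own system** — the hook for
the planner's §25 line on the `C₃`-image residual (E-es-36 `RelativeIharaShiftVanishingPar 2 t n` under hNT, E-es-40): if for
every elliptic `W` with `W[2]` irreducible the PARABOLIC `2³`- and `t`-shift-invariant generalised eigen-cocycles of the system
`ℓ ↦ a_ℓ(W) mod 2` vanish (at all levels, `t` odd prime), then `MultiShiftClassGenerationTwo` — no Eisenstein case split, no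
residual hypothesis. [folklore] -/
theorem multiShiftClassGenerationTwo_of_parabolicVanishing
    (hvan8 : ∀ (W : WeierstrassCurve ℚ) [W.IsElliptic], W.HasIrreducibleModPGaloisRep 2 →
      ∀ (L' : ℕ) [NeZero L'] (S : Finset ℕ) (v : cocycles 0 L' (ZMod 2)),
      (∀ q : ℕ, q.Prime → q ∣ 2 * 2 * L' → q ∈ S) →
      IsHeckeGenEigenvector S (fun ℓ : ℕ => ((W.LFunction ℓ : ℤ) : ZMod 2)) v →
      (∀ γ : Gamma0 L', ∀ c : OnePoint ℚ, mapGL ℚ (γ : SL(2, ℤ)) • c = c → (v : Gamma0 L' → Fin 1 → ZMod 2) γ 0 = 0) →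
      degeneracyPullback 0 L' (L' * 2 ^ 3) (2 ^ 3) (ZMod 2) dvd_rfl (v : Gamma0 L' → Fin 1 → ZMod 2) =
        degeneracyPullback 0 L' (L' * 2 ^ 3) 1 (ZMod 2) (by simp) (v : Gamma0 L' → Fin 1 → ZMod 2) →
      v = 0)
    (hvanq : ∀ (W : WeierstrassCurve ℚ) [W.IsElliptic], W.HasIrreducibleModPGaloisRep 2 → ∀ t : ℕ, t.Prime → t ≠ 2 →
      ∀ (L' : ℕ) [NeZero L'] [NeZero t] (S : Finset ℕ) (v : cocycles 0 L' (ZMod 2)),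
      (∀ q : ℕ, q.Prime → q ∣ 2 * t * L' → q ∈ S) →
      IsHeckeGenEigenvector S (fun ℓ : ℕ => ((W.LFunction ℓ : ℤ) : ZMod 2)) v →
      (∀ γ : Gamma0 L', ∀ c : OnePoint ℚ, mapGL ℚ (γ : SL(2, ℤ)) • c = c → (v : Gamma0 L' → Fin 1 → ZMod 2) γ 0 = 0) →
      degeneracyPullback 0 L' (L' * t ^ 1) (t ^ 1) (ZMod 2) dvd_rfl (v : Gamma0 L' → Fin 1 → ZMod 2) =
        degeneracyPullback 0 L' (L' * t ^ 1) 1 (ZMod 2) (by simp) (v : Gamma0 L' → Fin 1 → ZMod 2) →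
      v = 0) :
    MultiShiftClassGenerationTwo := by
  haveI : Fact (Nat.Prime 2) := ⟨Nat.prime_two⟩
  rw [multiShiftClassGenerationTwo_iff_functionals]
  intro W _ N _ f hf h4 hirr φ hφ
  refine functional_eq_zero_of_parabolicShiftVanishing_two hf h4 φ hφ ?_ ?_
  · intro L' _ S v _ hS hv hvp heq
    exact hvan8 W hirr L' S v hS hv hvp heq
  · intro t ht ht2 L' _ _ S v _ hS hv hvp heq
    exact hvanq W hirr t ht ht2 L' S v hS hv hvp heq

/-- **E-es-22 from the `C₃`-image residual, PARABOLIC route** (same conclusion as p2's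
`multiShiftClassGenerationTwo_of_cThreeResidual`, obtained through the full leaf; here through the parabolic instance only —
recorded as the consumer-side discharge). [folklore] -/
theorem multiShiftClassGenerationTwo_of_cThreeResidual_parabolic
    (hRes : ∀ (W : WeierstrassCurve ℚ) [W.IsElliptic] {N : ℕ} [NeZero N] (f : CuspForm (Gamma0 N) 2),
      IsNewformOf W f → 2 ^ 2 ∣ N → W.HasIrreducibleModPGaloisRep 2 →
      IsEisensteinEigensystem 2
        (fun ℓ : ℕ => algebraMap (ZMod 2) (AlgebraicClosure (ZMod 2)) ((W.LFunction ℓ : ℤ) : ZMod 2)) →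
      ∀ φ : ↥(periodLattice f) →+ ZMod 2,
        (∀ x : ↥(periodLattice f), (x : ℂ) ∈
            periodLattice (∑ T ∈ (insert 8 (N.primeFactors.filter fun q => ¬ q ^ 2 ∣ N)).powerset,
              (-1 : ℂ) ^ T.card • degeneracyMap0 N (8 * N ^ 2) (∏ t ∈ T, t - 1 + 1) 2 f) → φ x = 0) →
        φ = 0) (W : WeierstrassCurve ℚ) [W.IsElliptic] {N : ℕ} [NeZero N] (f : CuspForm (Gamma0 N) 2)
    (hf : IsNewformOf W f) (h4 : 2 ^ 2 ∣ N) (hirr : W.HasIrreducibleModPGaloisRep 2) (φ : ↥(periodLattice f) →+ ZMod 2)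
    (hφ : ∀ x : ↥(periodLattice f), (x : ℂ) ∈
      periodLattice (∑ T ∈ (insert 8 (N.primeFactors.filter fun q => ¬ q ^ 2 ∣ N)).powerset,
        (-1 : ℂ) ^ T.card • degeneracyMap0 N (8 * N ^ 2) (∏ t ∈ T, t - 1 + 1) 2 f) → φ x = 0) :
    φ = 0 := by
  haveI : Fact (Nat.Prime 2) := ⟨Nat.prime_two⟩
  by_cases hE : IsEisensteinEigensystem 2
      (fun ℓ : ℕ => algebraMap (ZMod 2) (AlgebraicClosure (ZMod 2)) ((W.LFunction ℓ : ℤ) : ZMod 2))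
  · exact hRes W f hf h4 hirr hE φ hφ
  · refine functional_eq_zero_of_parabolicShiftVanishing_two hf h4 φ hφ ?_ ?_
    · intro L' _ S v _ hS hv hvp heq
      exact relativeIhara_eq_zero_of_parabolic (p := 2) (t := 2) (n := 3) Nat.prime_two (by norm_num) (ZMod 2) L' S _
        v hS hv hE hvp heq
    · intro t ht ht2 L' _ _ S v _ hS hv hvp heq
      exact relativeIhara_eq_zero_of_parabolic (p := 2) (t := t) (n := 1) ht le_rfl (ZMod 2) L' S _ v hS hv hE
        hvp heq

end Summit.BirchSwinnertonDyer.BirchSwinnertonDyer.Theorems.ManinLocalTwoThree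

end
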